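import Summits.BirchSwinnertonDyer.BirchSwinnertonDyer.Theses.SignedBaseChange
import Literature.NumberTheory.EllipticCurves.BurungaleCastellaSkinner2025.BDPMainConjecture
import Literature.NumberTheory.EllipticCurves.BurungaleCastellaSkinner2025.ProductDivisibilitiesIntegralityProofs
import Literature.NumberTheory.EllipticCurves.YanZhu2026.GreenbergMainTheoremsAnyRoot
import Literature.NumberTheory.EllipticCurves.AnticyclotomicSignedHeegnerClasses
import HarnessLib

/-! # Sub-skeleton `primkoly` for stub S1 = `Bdpline.stub_bdpLowerHalfExistsSS` of the line of record
`Lines/bdpline.lean` on the crux `AnticyclotomicEisensteinDivisibility` (stmt-BirchSwinnertonDyer-20727, route SignedBaseChange).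

NOT A CRUX LINE, NOT REGISTERED (W-79, director-bsd g12 2026-08-28 06:09Z: `bdpline` stays the skeleton of record; this file is
published with `ledger crux write` only and must NOT be `skeleton check`ed — its top theorem concludes S1's STATEMENT verbatim, not
the crux by name). It is the checked form of the crux idea card `Ideas/primkoly.md` (bsd-idea-14 g1, lens=complete): a SPLICE the
lead may adopt in a future bdpline revision by replacing `stub_bdpLowerHalfExistsSS` with the three stubs below (the composition
`bdpLowerHalfExistsSS_of` then discharges S1; bdpline's own composition is untouched).

THE MOVE. S1 (the INTEGRAL Eisenstein half `ch_Λ(X_ac)·𝒪 ⊆ (𝓛_p^BDP)` at split supersingular `p ≥ 5`, some frame) ⟸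
  * `stub_signedHPMCEisensteinUpToP` (KOLY, RESEARCH = K1 ∧ K2 of the card, C⁺): the Eisenstein direction of the SIGNED Heegner point main
    conjecture (Castella–Wan 2024 Conj. 4.8) UP TO A POWER OF `p`, on the tree's carriers `AcSigned.X.torsionCharIdeal`,
    `AcSigned.signedHeegnerCharIdeal` — to be obtained from P-wise non-triviality of the Λ^ac-adic signed Heegner Kolyvagin system
    (CW24 Thm. A.4) via C.-H. Kim's height-one-prime criterion (arXiv:2203.12161 Thm. 7.7, printed at ordinary `p`; the ± port is the
    author-named gap of Remark 7.10), fed at finite level by Kolyvagin non-vanishing at supersingular `p` (Sweeting arXiv:2012.11771 Thm. 1.1);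
  * `stub_transferCW68` (T68, PRINT + dictionary = K3): CW24 Thm. 6.8 transports C⁺ to BDP currency, giving S1 UP TO `p^k` for some BDP frame;
  * `stub_bdpFrameUnitContent` (UC, PRINT): every BDP frame has `μ = 0` (BCS25 Prop. 4.2.2 = `prop422_exists_isBDPLFunction_mu_eq_zero` for one
    frame + frame rigidity `X11b.R1.exists_unit_mul_eq_of_isBDPLFunctionInt` + `hasUnitContent_map_iff_of_coe_eq`);
  glued by the PROVED one-variable cancellation `le_span_of_span_pow_mul_le_of_hasUnitContent` (embed `𝒪⟦T₂⟧ ↪ 𝒪⟦T₂⟧⟦T₁⟧` as constants and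
  use the tree's two-variable Gauss-lemma cancellation `le_span_of_span_natCast_pow_mul_le_of_hasUnitContent_minus`): `p^k·𝔞 ⊆ (L)`, `μ(L) = 0` ⟹ `𝔞 ⊆ (L)`.
Nothing here proves BSD or the crux; three `sorry`s = three stubs, zero elsewhere.
-/

-- D-0017: single-problem summit, the namespace repeats the problem name by design.
set_option linter.dupNamespace false
set_option autoImplicit false

noncomputable section

namespace Summit.BirchSwinnertonDyer.BirchSwinnertonDyer.Cruxes.AnticyclotomicEisensteinDivisibility.Primkoly

open Summit.BirchSwinnertonDyer.BirchSwinnertonDyer.Theses.SignedBaseChange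
open Literature.NumberTheory.EllipticCurves Literature.NumberTheory.EllipticCurves.Module
open Literature.NumberTheory.EllipticCurves.ModularForms
open Literature.NumberTheory.EllipticCurves.GreenbergVatsal2000

/-! ## The stubs -/

/-- stub KOLY (RESEARCH, load-bearing; = the card's transfer target C⁺ = K1 ∧ K2): **the Eisenstein direction of the signed Heegner point
main conjecture up to a power of `p`** — for every `AcSigned.Setting` (p odd good supersingular, split, `a_p = 0`, κ anticyclotomic,
`p ∤ h_K`), classical Heegner hypothesis, `3 < p`, `ρ̄` surjective, every trace-coherent Heegner family and every Λ-adic signed Heegner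
class `z`: `p^k · char(X_{±,tors}) ⊆ char(Sel_± / Λ z)^2` for some `k`. The converse inclusion is the tree's Howard^± fact
`AcSigned.castellaWan2024_thmA5_signedSelmer_rank_one_dvd_sq` (there with `Squarefree N`, used only for surjectivity via [Edi97]). -/
theorem stub_signedHPMCEisensteinUpToP :
    ∀ (N : ℕ) [NeZero N] (W : WeierstrassCurve ℚ) [W.IsGloballyMinimal] (K : Type) [Field K]
    [NumberField K] (p : ℕ) [Fact p.Prime] (κ : ZpExtension K p)
    (𝔭 𝔭' : IsDedekindDomain.HeightOneSpectrum (NumberField.RingOfIntegers K))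
    (jbar : AlgebraicClosure K →+* ℂ) (_ : AcSigned.Setting W K p κ 𝔭 𝔭'),
    (W.conductorNorm ℤ : ℕ) = N → SatisfiesHeegnerHypothesis N K → 3 < p →
    W.HasSurjectiveModNGaloisRep p →
    ∀ (γ : Field.absoluteGaloisGroup K) (hγ : κ.IsTopGenerator γ)
      (F : HeegnerFamily N W K κ jbar), F.IsTraceCoherentApZero → ∀ (ε : ℤˣ)
      (z : AcSigned.selmerLambdaAdic (W.baseChange K) p κ γ (fun _ ↦ .sgn ε)),
      AcSigned.IsSignedHeegnerClass p κ γ F ε z.1 →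
      ∃ k : ℕ, Ideal.span {((p : ℕ) : IwasawaAlgebra p) ^ k} *
          AcSigned.X.torsionCharIdeal (W.baseChange K) p κ ∅ (fun _ ↦ .sgn ε) hγ ≤
        AcSigned.signedHeegnerCharIdeal hγ ε z ^ 2 := by
  sorry

/-- stub T68 (PRINT + currency dictionary = K3): **Castella–Wan 2024 Thm. 6.8 transports C⁺ to BDP currency** — the identity
`char(X^{rel,str})·char(Sel_±/Λz^±)·Λ^ur = char(X^±_tors)·(L_p^BDP)` of its proof (MS p. 31) turns the signed inclusion up to `p^k` into
`p^k · ch_Λ(X_ac)·𝒪 ⊆ (𝓛)` for SOME BDP frame `𝓛` (S1's own existential frame), for every structure-compatible `J`, `J₀`. Why it might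
fail: the local conditions of the tree's `Castella2018.AcSelmer.XAc … ∅` vs CW's `X^{rel,str}` at the split `w ∣ N` and the normalisation
`IsBDPLFunction` vs CW's `L_p^BDP ∈ Λ^ur` (a square) must be matched — a dictionary, not new mathematics, but untyped. -/
theorem stub_transferCW68 :
    (∀ (N : ℕ) [NeZero N] (W : WeierstrassCurve ℚ) [W.IsGloballyMinimal] (K : Type) [Field K]
    [NumberField K] (p : ℕ) [Fact p.Prime] (κ : ZpExtension K p)
    (𝔭 𝔭' : IsDedekindDomain.HeightOneSpectrum (NumberField.RingOfIntegers K))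
    (jbar : AlgebraicClosure K →+* ℂ) (_ : AcSigned.Setting W K p κ 𝔭 𝔭'),
    (W.conductorNorm ℤ : ℕ) = N → SatisfiesHeegnerHypothesis N K → 3 < p →
    W.HasSurjectiveModNGaloisRep p →
    ∀ (γ : Field.absoluteGaloisGroup K) (hγ : κ.IsTopGenerator γ)
      (F : HeegnerFamily N W K κ jbar), F.IsTraceCoherentApZero → ∀ (ε : ℤˣ)
      (z : AcSigned.selmerLambdaAdic (W.baseChange K) p κ γ (fun _ ↦ .sgn ε)),
      AcSigned.IsSignedHeegnerClass p κ γ F ε z.1 →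
      ∃ k : ℕ, Ideal.span {((p : ℕ) : IwasawaAlgebra p) ^ k} *
          AcSigned.X.torsionCharIdeal (W.baseChange K) p κ ∅ (fun _ ↦ .sgn ε) hγ ≤
        AcSigned.signedHeegnerCharIdeal hγ ε z ^ 2) →
    SignedTwoVariableInputs → Literature.NumberTheory.EllipticCurves.ModularForms.nonempty_modularParametrizationData → ∀ (W : WeierstrassCurve ℚ) [W.IsElliptic] [W.IsGloballyMinimal] (p : ℕ) [Fact p.Prime], 5 ≤ p → W.HasGoodReductionAtPrime p → W.frobeniusTrace p = 0 → Literature.NumberTheory.EllipticCurves.Rank1Residual.Surj W p → ∀ (K : Type) [Field K] [NumberField K] (ι : PadicAlgCl p ≃+* ℂ) (v vbar : IsDedekindDomain.HeightOneSpectrum (NumberField.RingOfIntegers K)) (κ₁ κ₂ : Literature.NumberTheory.EllipticCurves.ZpExtension K p) (γ₁ γ₂ : Field.absoluteGaloisGroup K) [Fact (Literature.NumberTheory.EllipticCurves.ZpExtension.IsTopGeneratorPair κ₁ κ₂ γ₁ γ₂)] [NeZero (NumberField.discr K).natAbs] (N : ℕ) [NeZero N] (f : CuspForm (CongruenceSubgroup.Gamma0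 N) 2), Literature.NumberTheory.EllipticCurves.ModularForms.IsNewformOf W f → (N : ℤ) = W.conductorNorm ℤ → Literature.NumberTheory.EllipticCurves.IsImaginaryQuadratic K → ((Ideal.span {(p : ℤ)}).primesOver (NumberField.RingOfIntegers K)).ncard = 2 → ((p : ℕ) : NumberField.RingOfIntegers K) ∈ v.asIdeal → ((p : ℕ) : NumberField.RingOfIntegers K) ∈ vbar.asIdeal → vbar ≠ v → (∀ (w : NumberField.InfinitePlace K) (k : NumberField.RingOfIntegers K), k ∈ v.asIdeal ↔ ‖ι.symm (w.embedding (k : K))‖ < 1) → IsCoprime (N : ℤ) (NumberField.discr K) → (∀ ℓ : ℕ, ℓ.Prime → ℓ ∣ N → ((Ideal.span {(ℓ : ℤ)}).primesOver (NumberField.RingOfIntegers K)).ncard = 2) → Odd (NumberField.discr K) → NumberField.discr K ≠ -3 → κ₁.IsCyclotomic → κ₂.IsAnticyclotomic → ∃ (ΩK : ℂ) (Ωp' : (Literature.NumberTheory.EllipticCurves.unrIntegers p)ˣ) (L : Literature.NumberTheory.EllipticCurves.UnrSeries p), ΩK ≠ 0 ∧ Literature.NumberTheory.EllipticCurves.IsBDPLFunction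 ι v κ₂ γ₂ f ΩK ((Ωp' : Literature.NumberTheory.EllipticCurves.unrIntegers p) : PadicComplex p) L ∧ ∀ J : ℤ_[p] →+* PadicComplexInt p, (∀ x : ℤ_[p], ((J x : PadicComplexInt p) : PadicComplex p) = ((x : ℚ_[p]) : PadicComplex p)) → ∀ (J₀ : Literature.NumberTheory.EllipticCurves.unrIntegers p →+* PadicComplexInt p), (∀ x : Literature.NumberTheory.EllipticCurves.unrIntegers p, ((J₀ x : PadicComplexInt p) : PadicComplex p) = (x : PadicComplex p)) → ∃ k : ℕ, Ideal.span {((p : ℕ) : PowerSeries (PadicComplexInt p)) ^ k} * (haveI : Fact (κ₂.IsTopGenerator γ₂) := ⟨Literature.NumberTheory.EllipticCurves.YanZhu2026.isTopGenerator_of_pair (κ₁ := κ₁) (γ₁ := γ₁)⟩; Literature.NumberTheory.EllipticCurves.Castella2018.AcSelmer.XAc.charIdeal (W.baseChange K) p κ₂ vbar ∅ γ₂).map (PowerSeries.map J) ≤ Ideal.span {PowerSeries.map J₀ L} := by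
  sorry

/-- stub UC (PRINT): **every BDP frame has `μ = 0`** — `IsBDPLFunction ι v κ₂ γ₂ f ΩK Ωp' L` with `ΩK ≠ 0`, `Ωp'` a unit ⟹ `L` has a unit
coefficient: BCS25 Prop. 4.2.2 (`prop422_exists_isBDPLFunction_mu_eq_zero`, PUB; Hsieh 2014 / Burungale 2017) gives ONE such frame, frame
rigidity (`X11b.R1.exists_unit_mul_eq_of_isBDPLFunctionInt`: two frames differ by a unit of `𝒪_{ℂ_p}⟦T⟧` after `unrToCpInt`) and
`HasUnitContent.of_span_singleton_eq` / `hasUnitContent_map_iff_of_coe_eq` move `μ = 0` to every frame. Closable modulo the PUB fact. -/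
theorem stub_bdpFrameUnitContent :
    SignedTwoVariableInputs → Literature.NumberTheory.EllipticCurves.ModularForms.nonempty_modularParametrizationData → ∀ (W : WeierstrassCurve ℚ) [W.IsElliptic] [W.IsGloballyMinimal] (p : ℕ) [Fact p.Prime], 5 ≤ p → W.HasGoodReductionAtPrime p → W.frobeniusTrace p = 0 → Literature.NumberTheory.EllipticCurves.Rank1Residual.Surj W p → ∀ (K : Type) [Field K] [NumberField K] (ι : PadicAlgCl p ≃+* ℂ) (v vbar : IsDedekindDomain.HeightOneSpectrum (NumberField.RingOfIntegers K)) (κ₁ κ₂ : Literature.NumberTheory.EllipticCurves.ZpExtension K p) (γ₁ γ₂ : Field.absoluteGaloisGroup K) [Fact (Literature.NumberTheory.EllipticCurves.ZpExtension.IsTopGeneratorPair κ₁ κ₂ γ₁ γ₂)] [NeZero (NumberField.discr K).natAbs] (N : ℕ) [NeZero N] (f : CuspForm (CongruenceSubgroup.Gamma0 N) 2), Literature.NumberTheory.EllipticCurves.ModularForms.IsNewformOf W f → (N : ℤ) = W.conductorNorm ℤ → Literature.NumberTheory.EllipticCurves.IsImaginaryQuadratic K → ((Ideal.span {(p : ℤ)}).primesOver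 (NumberField.RingOfIntegers K)).ncard = 2 → ((p : ℕ) : NumberField.RingOfIntegers K) ∈ v.asIdeal → ((p : ℕ) : NumberField.RingOfIntegers K) ∈ vbar.asIdeal → vbar ≠ v → (∀ (w : NumberField.InfinitePlace K) (k : NumberField.RingOfIntegers K), k ∈ v.asIdeal ↔ ‖ι.symm (w.embedding (k : K))‖ < 1) → IsCoprime (N : ℤ) (NumberField.discr K) → (∀ ℓ : ℕ, ℓ.Prime → ℓ ∣ N → ((Ideal.span {(ℓ : ℤ)}).primesOver (NumberField.RingOfIntegers K)).ncard = 2) → Odd (NumberField.discr K) → NumberField.discr K ≠ -3 → κ₁.IsCyclotomic → κ₂.IsAnticyclotomic → ∀ (ΩK : ℂ) (Ωp' : (Literature.NumberTheory.EllipticCurves.unrIntegers p)ˣ) (L : Literature.NumberTheory.EllipticCurves.UnrSeries p), ΩK ≠ 0 → Literature.NumberTheory.EllipticCurves.IsBDPLFunction ι v κ₂ γ₂ f ΩK ((Ωp' : Literature.NumberTheory.EllipticCurves.unrIntegers p) : PadicComplex p) L → Literature.NumberTheory.EllipticCurves.GreenbergVatsal2000.HasUnitContent L := by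
  sorry

/-! ## Glue (PROVED): one-variable cancellation of a power of `p` against `μ = 0` over `𝒪_{ℂ_p}⟦T⟧` -/

/-- **`p^k·𝔞 ⊆ (L)` and `μ(L) = 0` ⟹ `𝔞 ⊆ (L)` in `𝒪_{ℂ_p}⟦T⟧`**: embed `𝒪_{ℂ_p}⟦T₂⟧ ↪ 𝒪_{ℂ_p}⟦T₂⟧⟦T₁⟧` as `T₁`-constants
(`PowerSeries.C`), apply the tree's two-variable cancellation `le_span_of_span_natCast_pow_mul_le_of_hasUnitContent_minus`
(`(C L)⁻ = L`), and return along `constantCoeff ∘ C = id`. -/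
theorem le_span_of_span_pow_mul_le_of_hasUnitContent {p : ℕ} [Fact p.Prime]
    {L : PowerSeries (PadicComplexInt p)} (hL : HasUnitContent L)
    {I : Ideal (PowerSeries (PadicComplexInt p))} {k : ℕ}
    (h : Ideal.span {((p : ℕ) : PowerSeries (PadicComplexInt p)) ^ k} * I ≤ Ideal.span {L}) :
    I ≤ Ideal.span {L} := by
  have hG : HasUnitContent (UnrSeries₂.minus (PowerSeries.C (R := PowerSeries (PadicComplexInt p)) L)) := by
    simpa [UnrSeries₂.minus] using hL
  have h2 : Ideal.span {((p : ℕ) : PowerSeries (PowerSeries (PadicComplexInt p))) ^ k} *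
      I.map (PowerSeries.C (R := PowerSeries (PadicComplexInt p))) ≤
      Ideal.span {PowerSeries.C (R := PowerSeries (PadicComplexInt p)) L} := by
    have h' := Ideal.map_mono (f := PowerSeries.C (R := PowerSeries (PadicComplexInt p))) h
    rwa [Ideal.map_mul, Ideal.map_span, Set.image_singleton, Ideal.map_span, Set.image_singleton, map_pow,
      map_natCast] at h'
  have h3 := le_span_of_span_natCast_pow_mul_le_of_hasUnitContent_minus hG h2
  have h4 := Ideal.map_mono (f := PowerSeries.constantCoeff (R := PowerSeries (PadicComplexInt p))) h3
  have hcomp : (PowerSeries.constantCoeff (R := PowerSeries (PadicComplexInt p))).comp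
      (PowerSeries.C (R := PowerSeries (PadicComplexInt p))) = RingHom.id _ := by
    ext x
    simp
  rwa [Ideal.map_map, hcomp, Ideal.map_id, Ideal.map_span, Set.image_singleton, PowerSeries.constantCoeff_C] at h4

/-! ## The composition: S1's statement VERBATIM (text of `Bdpline.stub_bdpLowerHalfExistsSS`, bdpline v6) from the three stubs -/

/-- **KOLY → T68 → UC → S1.** The frame is T68's; UC makes its `μ` vanish; the cancellation removes `p^k`. Concludes the TEXT of
`Bdpline.stub_bdpLowerHalfExistsSS` (δ-equal restatement; this file does not import the line of record). -/
theorem bdpLowerHalfExistsSS_of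
    (hKoly : ∀ (N : ℕ) [NeZero N] (W : WeierstrassCurve ℚ) [W.IsGloballyMinimal] (K : Type) [Field K]
    [NumberField K] (p : ℕ) [Fact p.Prime] (κ : ZpExtension K p)
    (𝔭 𝔭' : IsDedekindDomain.HeightOneSpectrum (NumberField.RingOfIntegers K))
    (jbar : AlgebraicClosure K →+* ℂ) (_ : AcSigned.Setting W K p κ 𝔭 𝔭'),
    (W.conductorNorm ℤ : ℕ) = N → SatisfiesHeegnerHypothesis N K → 3 < p →
    W.HasSurjectiveModNGaloisRep p →
    ∀ (γ : Field.absoluteGaloisGroup K) (hγ : κ.IsTopGenerator γ)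
      (F : HeegnerFamily N W K κ jbar), F.IsTraceCoherentApZero → ∀ (ε : ℤˣ)
      (z : AcSigned.selmerLambdaAdic (W.baseChange K) p κ γ (fun _ ↦ .sgn ε)),
      AcSigned.IsSignedHeegnerClass p κ γ F ε z.1 →
      ∃ k : ℕ, Ideal.span {((p : ℕ) : IwasawaAlgebra p) ^ k} *
          AcSigned.X.torsionCharIdeal (W.baseChange K) p κ ∅ (fun _ ↦ .sgn ε) hγ ≤
        AcSigned.signedHeegnerCharIdeal hγ ε z ^ 2)
    (hT68 : (∀ (N : ℕ) [NeZero N] (W : WeierstrassCurve ℚ) [W.IsGloballyMinimal] (K : Type) [Field K]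
    [NumberField K] (p : ℕ) [Fact p.Prime] (κ : ZpExtension K p)
    (𝔭 𝔭' : IsDedekindDomain.HeightOneSpectrum (NumberField.RingOfIntegers K))
    (jbar : AlgebraicClosure K →+* ℂ) (_ : AcSigned.Setting W K p κ 𝔭 𝔭'),
    (W.conductorNorm ℤ : ℕ) = N → SatisfiesHeegnerHypothesis N K → 3 < p →
    W.HasSurjectiveModNGaloisRep p →
    ∀ (γ : Field.absoluteGaloisGroup K) (hγ : κ.IsTopGenerator γ)
      (F : HeegnerFamily N W K κ jbar), F.IsTraceCoherentApZero → ∀ (ε : ℤˣ)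
      (z : AcSigned.selmerLambdaAdic (W.baseChange K) p κ γ (fun _ ↦ .sgn ε)),
      AcSigned.IsSignedHeegnerClass p κ γ F ε z.1 →
      ∃ k : ℕ, Ideal.span {((p : ℕ) : IwasawaAlgebra p) ^ k} *
          AcSigned.X.torsionCharIdeal (W.baseChange K) p κ ∅ (fun _ ↦ .sgn ε) hγ ≤
        AcSigned.signedHeegnerCharIdeal hγ ε z ^ 2) →
      SignedTwoVariableInputs → Literature.NumberTheory.EllipticCurves.ModularForms.nonempty_modularParametrizationData → ∀ (W : WeierstrassCurve ℚ) [W.IsElliptic] [W.IsGloballyMinimal] (p : ℕ) [Fact p.Prime], 5 ≤ p → W.HasGoodReductionAtPrime p → W.frobeniusTrace p = 0 → Literature.NumberTheory.EllipticCurves.Rank1Residual.Surj W p → ∀ (K : Type) [Field K] [NumberField K] (ι : PadicAlgCl p ≃+* ℂ) (v vbar : IsDedekindDomain.HeightOneSpectrum (NumberField.RingOfIntegers K)) (κ₁ κ₂ : Literature.NumberTheory.EllipticCurves.ZpExtension K p) (γ₁ γ₂ : Field.absoluteGaloisGroup K) [Fact (Literature.NumberTheory.EllipticCurves.ZpExtension.IsTopGeneratorPair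 κ₁ κ₂ γ₁ γ₂)] [NeZero (NumberField.discr K).natAbs] (N : ℕ) [NeZero N] (f : CuspForm (CongruenceSubgroup.Gamma0 N) 2), Literature.NumberTheory.EllipticCurves.ModularForms.IsNewformOf W f → (N : ℤ) = W.conductorNorm ℤ → Literature.NumberTheory.EllipticCurves.IsImaginaryQuadratic K → ((Ideal.span {(p : ℤ)}).primesOver (NumberField.RingOfIntegers K)).ncard = 2 → ((p : ℕ) : NumberField.RingOfIntegers K) ∈ v.asIdeal → ((p : ℕ) : NumberField.RingOfIntegers K) ∈ vbar.asIdeal → vbar ≠ v → (∀ (w : NumberField.InfinitePlace K) (k : NumberField.RingOfIntegers K), k ∈ v.asIdeal ↔ ‖ι.symm (w.embedding (k : K))‖ < 1) → IsCoprime (N : ℤ) (NumberField.discr K) → (∀ ℓ : ℕ, ℓ.Prime → ℓ ∣ N → ((Ideal.span {(ℓ : ℤ)}).primesOver (NumberField.RingOfIntegers K)).ncard = 2) → Odd (NumberField.discr K) → NumberField.discr K ≠ -3 → κ₁.IsCyclotomic → κ₂.IsAnticyclotomic → ∃ (ΩK : ℂ) (Ωp' : (Literature.NumberTheory.EllipticCurves.unrIntegers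 p)ˣ) (L : Literature.NumberTheory.EllipticCurves.UnrSeries p), ΩK ≠ 0 ∧ Literature.NumberTheory.EllipticCurves.IsBDPLFunction ι v κ₂ γ₂ f ΩK ((Ωp' : Literature.NumberTheory.EllipticCurves.unrIntegers p) : PadicComplex p) L ∧ ∀ J : ℤ_[p] →+* PadicComplexInt p, (∀ x : ℤ_[p], ((J x : PadicComplexInt p) : PadicComplex p) = ((x : ℚ_[p]) : PadicComplex p)) → ∀ (J₀ : Literature.NumberTheory.EllipticCurves.unrIntegers p →+* PadicComplexInt p), (∀ x : Literature.NumberTheory.EllipticCurves.unrIntegers p, ((J₀ x : PadicComplexInt p) : PadicComplex p) = (x : PadicComplex p)) → ∃ k : ℕ, Ideal.span {((p : ℕ) : PowerSeries (PadicComplexInt p)) ^ k} * (haveI : Fact (κ₂.IsTopGenerator γ₂) := ⟨Literature.NumberTheory.EllipticCurves.YanZhu2026.isTopGenerator_of_pair (κ₁ := κ₁) (γ₁ := γ₁)⟩; Literature.NumberTheory.EllipticCurves.Castella2018.AcSelmer.XAc.charIdeal (W.baseChange K) p κ₂ vbar ∅ γ₂).map (PowerSeries.map J) ≤ Ideal.span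 {PowerSeries.map J₀ L})
    (hUC : SignedTwoVariableInputs → Literature.NumberTheory.EllipticCurves.ModularForms.nonempty_modularParametrizationData → ∀ (W : WeierstrassCurve ℚ) [W.IsElliptic] [W.IsGloballyMinimal] (p : ℕ) [Fact p.Prime], 5 ≤ p → W.HasGoodReductionAtPrime p → W.frobeniusTrace p = 0 → Literature.NumberTheory.EllipticCurves.Rank1Residual.Surj W p → ∀ (K : Type) [Field K] [NumberField K] (ι : PadicAlgCl p ≃+* ℂ) (v vbar : IsDedekindDomain.HeightOneSpectrum (NumberField.RingOfIntegers K)) (κ₁ κ₂ : Literature.NumberTheory.EllipticCurves.ZpExtension K p) (γ₁ γ₂ : Field.absoluteGaloisGroup K) [Fact (Literature.NumberTheory.EllipticCurves.ZpExtension.IsTopGeneratorPair κ₁ κ₂ γ₁ γ₂)] [NeZero (NumberField.discr K).natAbs] (N : ℕ) [NeZero N] (f : CuspForm (CongruenceSubgroup.Gamma0 N) 2), Literature.NumberTheory.EllipticCurves.ModularForms.IsNewformOf W f → (N : ℤ) = W.conductorNorm ℤ → Literature.NumberTheory.EllipticCurves.IsImaginaryQuadratic K → ((Ideal.span {(p :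 ℤ)}).primesOver (NumberField.RingOfIntegers K)).ncard = 2 → ((p : ℕ) : NumberField.RingOfIntegers K) ∈ v.asIdeal → ((p : ℕ) : NumberField.RingOfIntegers K) ∈ vbar.asIdeal → vbar ≠ v → (∀ (w : NumberField.InfinitePlace K) (k : NumberField.RingOfIntegers K), k ∈ v.asIdeal ↔ ‖ι.symm (w.embedding (k : K))‖ < 1) → IsCoprime (N : ℤ) (NumberField.discr K) → (∀ ℓ : ℕ, ℓ.Prime → ℓ ∣ N → ((Ideal.span {(ℓ : ℤ)}).primesOver (NumberField.RingOfIntegers K)).ncard = 2) → Odd (NumberField.discr K) → NumberField.discr K ≠ -3 → κ₁.IsCyclotomic → κ₂.IsAnticyclotomic → ∀ (ΩK : ℂ) (Ωp' : (Literature.NumberTheory.EllipticCurves.unrIntegers p)ˣ) (L : Literature.NumberTheory.EllipticCurves.UnrSeries p), ΩK ≠ 0 → Literature.NumberTheory.EllipticCurves.IsBDPLFunction ι v κ₂ γ₂ f ΩK ((Ωp' : Literature.NumberTheory.EllipticCurves.unrIntegers p) : PadicComplex p) L → Literature.NumberTheory.EllipticCurves.GreenbergVatsal2000.HasUnitContent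 L) :
    SignedTwoVariableInputs → Literature.NumberTheory.EllipticCurves.ModularForms.nonempty_modularParametrizationData → ∀ (W : WeierstrassCurve ℚ) [W.IsElliptic] [W.IsGloballyMinimal] (p : ℕ) [Fact p.Prime], 5 ≤ p → W.HasGoodReductionAtPrime p → W.frobeniusTrace p = 0 → Literature.NumberTheory.EllipticCurves.Rank1Residual.Surj W p → ∀ (K : Type) [Field K] [NumberField K] (ι : PadicAlgCl p ≃+* ℂ) (v vbar : IsDedekindDomain.HeightOneSpectrum (NumberField.RingOfIntegers K)) (κ₁ κ₂ : Literature.NumberTheory.EllipticCurves.ZpExtension K p) (γ₁ γ₂ : Field.absoluteGaloisGroup K) [Fact (Literature.NumberTheory.EllipticCurves.ZpExtension.IsTopGeneratorPair κ₁ κ₂ γ₁ γ₂)] [NeZero (NumberField.discr K).natAbs] (N : ℕ) [NeZero N] (f : CuspForm (CongruenceSubgroup.Gamma0 N) 2), Literature.NumberTheory.EllipticCurves.ModularForms.IsNewformOf W f → (N : ℤ) = W.conductorNorm ℤ → Literature.NumberTheory.EllipticCurves.IsImaginaryQuadratic K → ((Ideal.span {(p : ℤ)}).primesOver (NumberField.RingOfIntegers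 K)).ncard = 2 → ((p : ℕ) : NumberField.RingOfIntegers K) ∈ v.asIdeal → ((p : ℕ) : NumberField.RingOfIntegers K) ∈ vbar.asIdeal → vbar ≠ v → (∀ (w : NumberField.InfinitePlace K) (k : NumberField.RingOfIntegers K), k ∈ v.asIdeal ↔ ‖ι.symm (w.embedding (k : K))‖ < 1) → IsCoprime (N : ℤ) (NumberField.discr K) → (∀ ℓ : ℕ, ℓ.Prime → ℓ ∣ N → ((Ideal.span {(ℓ : ℤ)}).primesOver (NumberField.RingOfIntegers K)).ncard = 2) → Odd (NumberField.discr K) → NumberField.discr K ≠ -3 → κ₁.IsCyclotomic → κ₂.IsAnticyclotomic → ∃ (ΩK : ℂ) (Ωp' : (Literature.NumberTheory.EllipticCurves.unrIntegers p)ˣ) (L : Literature.NumberTheory.EllipticCurves.UnrSeries p), ΩK ≠ 0 ∧ Literature.NumberTheory.EllipticCurves.IsBDPLFunction ι v κ₂ γ₂ f ΩK ((Ωp' : Literature.NumberTheory.EllipticCurves.unrIntegers p) : PadicComplex p) L ∧ ∀ J : ℤ_[p] →+* PadicComplexInt p, (∀ x : ℤ_[p], ((J x : PadicComplexInt p) :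 PadicComplex p) = ((x : ℚ_[p]) : PadicComplex p)) → ∀ (J₀ : Literature.NumberTheory.EllipticCurves.unrIntegers p →+* PadicComplexInt p), (∀ x : Literature.NumberTheory.EllipticCurves.unrIntegers p, ((J₀ x : PadicComplexInt p) : PadicComplex p) = (x : PadicComplex p)) → (haveI : Fact (κ₂.IsTopGenerator γ₂) := ⟨Literature.NumberTheory.EllipticCurves.YanZhu2026.isTopGenerator_of_pair (κ₁ := κ₁) (γ₁ := γ₁)⟩; Literature.NumberTheory.EllipticCurves.Castella2018.AcSelmer.XAc.charIdeal (W.baseChange K) p κ₂ vbar ∅ γ₂).map (PowerSeries.map J) ≤ Ideal.span {PowerSeries.map J₀ L} := by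
  intro hIn hmodP W _ _ p _ hp hgood ha0 hs K _ _ ι v vbar κ₁ κ₂ γ₁ γ₂ _ _ N _ f hf hN hK hsplit hv hvbar hvv hι hcop hHeeg hodd
    hne3 hκ₁ hκ₂
  obtain ⟨ΩK, Ωp', L, hΩK, hL, hle⟩ := hT68 hKoly hIn hmodP W p hp hgood ha0 hs K ι v vbar κ₁ κ₂ γ₁ γ₂ N f hf hN hK hsplit hv hvbar
    hvv hι hcop hHeeg hodd hne3 hκ₁ hκ₂
  refine ⟨ΩK, Ωp', L, hΩK, hL, fun J hJ J₀ hJ₀ ↦ ?_⟩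
  obtain ⟨k, hk⟩ := hle J hJ J₀ hJ₀
  have hμ : HasUnitContent (PowerSeries.map J₀ L) :=
    (hUC hIn hmodP W p hp hgood ha0 hs K ι v vbar κ₁ κ₂ γ₁ γ₂ N f hf hN hK hsplit hv hvbar hvv hι hcop hHeeg hodd hne3 hκ₁ hκ₂
      ΩK Ωp' L hΩK hL).map J₀
  exact le_span_of_span_pow_mul_le_of_hasUnitContent hμ hk

end Summit.BirchSwinnertonDyer.BirchSwinnertonDyer.Cruxes.AnticyclotomicEisensteinDivisibility.Primkoly

end
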